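import Literature.NumberTheory.Transcendental.RoySmallValueEstimatesAlgPointLiouvilleProofs
import Literature.NumberTheory.Transcendental.RoySmallValueOrbitsK
import Mathlib.FieldTheory.IsAlgClosed.Basic
import HarnessLib

/-!
# Small value estimates at rational translates (Nguyen–Roy 2016) — proofs, XXVII: conjugates via a normal number field; orbits of zero configurations as algebraic points

Twenty-seventh proofs file towards `Literature.NumberTheory.Transcendental.nguyenRoy2016_thm_1` (Nguyen–Roy,
IJNT 12 (2016) = arXiv:1412.5163). Everything here is PROVED; no named facts. A bridge between the two
descriptions of a zero-dimensional `ℚ`-subvariety of `ℙ²(ℂ)` present in the tree: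

* the instantiation's `AlgPt` / `conj` (file XVI: the images of a point under all `ℚ`-embeddings
  of its field of definition `ℚ(P)`), and
* the seat-B configurations `Roy2013.ZeroConfigK K ι` (`RoySmallValueOrbitsK`: representatives
  with coordinates in a NORMAL number field `K ⊂ ℂ`, permuted by `Aut(K/ℚ)` via `perm`, with
  orbits `orb i₀`),

so that a supplier of Proposition 15 / Corollary 16 working with configurations can deliver the
`Cor16Data` of file XXIII:

* **`AlgPt.conj_eq_image_aut`** — if `b ∈ K³` are coordinates of `P` with `K ⊂ ℂ` normal and
  finite over `ℚ`, then `conj P = {[g(b)] : g ∈ Aut(K/ℚ)}` (every `ℚ`-embedding `ℚ(P) → ℂ`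
  extends to `K`, `IsAlgClosed.surjective_restrictDomain_of_isAlgebraic`, and an embedding of the
  normal field `K` is an automorphism followed by the inclusion, `Roy2013.ZeroConfigK.autOfEmb`);
* `ZeroConfigK.algPt Z i₀` — the point `[α_{i₀}]` as an `AlgPt`; **`conj_algPt`**:
  `conj [α_{i₀}] = {[α_j] : j ∈ orb i₀}`; `card_conj_algPt` (`deg = #orb`), `habs_mk_α`
  (`h_abs([α_j]) = h_K(rep j)/[K:ℚ]`) and **`ht_algPt`**:
  `ht [α_{i₀}] = ∑_{j ∈ orb i₀} h_K(rep j) / [K:ℚ]` (the "height of the component" of seat B).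

## References

* [NguyenRoy2016] N. A. V. Nguyen, D. Roy, IJNT 12 (2016) 1273–1293 = arXiv:1412.5163, §4
  (zero-dimensional `ℚ`-subvarieties, `deg`, `h`).
* [Roy2013] D. Roy, Mathematika 59 (2013), §6 (the conjugate points of `𝒵(P, Q)`).
-/

noncomputable section

open Height Module Finset
open Literature.NumberTheory.Transcendental.Roy2013 (ZeroConfigK)
open scoped Classical

namespace Literature.NumberTheory.Transcendental

namespace NguyenRoy

/-! ### Conjugates through a normal number field -/

namespace AlgPt

variable (P : AlgPt)

/-- **The conjugates through a normal number field.** If `b ∈ K³` are homogeneous coordinates of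
`P` with `K ⊂ ℂ` finite and normal over `ℚ`, then `conj P = {[g(b)] : g ∈ Aut(K/ℚ)}`.
[cite: NguyenRoy2016, §4; Roy2013, §6] -/
theorem conj_eq_image_aut {K : IntermediateField ℚ ℂ} [FiniteDimensional ℚ K] [Normal ℚ K]
    (b : Fin 3 → K) (hb : (fun j => ((b j : K) : ℂ)) ≠ 0) (hbP : Projectivization.mk ℂ _ hb = P.1) :
    P.conj = Finset.univ.image fun g : K ≃ₐ[ℚ] K =>
      Projectivization.mk ℂ (fun j => ((g (b j) : K) : ℂ))
        (map_vec_ne_zero ((K.val : K →ₐ[ℚ] ℂ).toRingHom.comp (g : K →+* K))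
          (vec_ne_zero_of_coe hb)) := by
  -- the pivot `k` and `nv P = b / b_k`
  set k : Fin 3 := pivot (fun j => ((b j : K) : ℂ)) with hk
  have hbk : ((b k : K) : ℂ) ≠ 0 := apply_pivot_ne_zero hb
  have hbk' : (b k : K) ≠ 0 := fun h => hbk (by rw [h]; rfl)
  have hnv : ∀ j, nv P.1 j = ((b j : K) : ℂ) / ((b k : K) : ℂ) := fun j => by
    have := (nv_mk hb).1
    rw [hbP] at this
    rw [this]
    rfl
  -- `ℚ(P) ≤ K`
  have hKE : Kp P.1 ≤ K := by
    refine IntermediateField.adjoin_le_iff.mpr ?_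
    rintro x ⟨j, rfl⟩
    rw [hnv]
    exact div_mem (b j).2 (b k).2
  have hrel2 : ∀ j, IntermediateField.inclusion hKE (ap P.1 j) = b j / b k := fun j => by
    apply Subtype.ext
    change nv P.1 j = (((b j / b k : K)) : ℂ)
    rw [hnv]
    simp
  -- the tower `ℚ ⊆ ℚ(P) ⊆ K`
  letI : Algebra (Kp P.1) K := (IntermediateField.inclusion hKE).toRingHom.toAlgebra
  haveI : IsScalarTower ℚ (Kp P.1) K := IsScalarTower.of_algebraMap_eq' (Subsingleton.elim _ _)
  haveI : Algebra.IsAlgebraic (Kp P.1) K :=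
    Algebra.IsAlgebraic.tower_top (K := ℚ) (Kp P.1)
  ext q
  simp only [conj, Finset.mem_image, Finset.mem_univ, true_and, embPt]
  constructor
  · rintro ⟨ψ, rfl⟩
    -- extend `ψ` to `K`, then restrict the extension to an automorphism of `K`
    obtain ⟨σ, hσ⟩ := IsAlgClosed.surjective_restrictDomain_of_isAlgebraic (K := ℚ) (L := Kp P.1)
      (M := ℂ) (E := K) ψ
    refine ⟨ZeroConfigK.autOfEmb (σ : K →+* ℂ), ?_⟩
    rw [Projectivization.mk_eq_mk_iff']
    refine ⟨σ (b k), funext fun j => ?_⟩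
    simp only [Pi.smul_apply, smul_eq_mul]
    rw [ZeroConfigK.coe_autOfEmb]
    have h1 : ψ (ap P.1 j) = σ (IntermediateField.inclusion hKE (ap P.1 j)) := by
      rw [← hσ]; rfl
    change (σ : K →+* ℂ) (b k) * ψ (ap P.1 j) = (σ : K →+* ℂ) (b j)
    rw [h1, hrel2, AlgHom.coe_toRingHom, map_div₀, mul_div_cancel₀]
    exact fun h => hbk' ((map_eq_zero_iff _ σ.toRingHom.injective).mp h)
  · rintro ⟨g, rfl⟩
    refine ⟨((K.val : K →ₐ[ℚ] ℂ).comp (g : K →ₐ[ℚ] K)).comp (IntermediateField.inclusion hKE), ?_⟩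
    rw [Projectivization.mk_eq_mk_iff']
    refine ⟨(((g (b k) : K) : ℂ))⁻¹, funext fun j => ?_⟩
    have h2 := congrArg (fun x : K => ((g x : K) : ℂ)) (hrel2 j)
    simp only [map_div₀] at h2
    simp only [Pi.smul_apply, smul_eq_mul, AlgHom.coe_comp, Function.comp_apply]
    change _ = (((g (IntermediateField.inclusion hKE (ap P.1 j))) : K) : ℂ)
    rw [h2]
    have hgk : (((g (b k)) : K) : ℂ) ≠ 0 := fun h =>
      hbk' ((map_eq_zero_iff g g.injective).mp (Subtype.ext h))
    push_cast
    field_simp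

end AlgPt

/-! ### Orbits of zero configurations as algebraic points -/

namespace ZeroConfigBridge

variable {K : IntermediateField ℚ ℂ} [NumberField K] {ι : Type*} [Fintype ι] (Z : ZeroConfigK K ι)

/-- The point `[α_i]` is algebraic (coordinates in the number field `K`). [folklore] -/
theorem isAlgPt_α (i : ι) : IsAlgPt (Projectivization.mk ℂ (Z.α i) (Z.α_ne_zero i)) :=
  ⟨⟨K, (K.val : K →ₐ[ℚ] ℂ).toRingHom, Z.rep i, Z.α_ne_zero i, rfl⟩⟩

/-- **The point `[α_{i₀}]` as an algebraic point of the instantiation.** [cite: NguyenRoy2016, §4] -/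
def algPt (i₀ : ι) : AlgPt := ⟨Projectivization.mk ℂ (Z.α i₀) (Z.α_ne_zero i₀), isAlgPt_α Z i₀⟩

/-- Its underlying point. [folklore] -/
@[simp] theorem algPt_val (i₀ : ι) :
    (algPt Z i₀).1 = Projectivization.mk ℂ (Z.α i₀) (Z.α_ne_zero i₀) := rfl

/-- `h_abs([α_j]) = h_K(rep j) / [K:ℚ]`. [cite: NguyenRoy2016, §4] -/
theorem habs_mk_α (j : ι) :
    habs (Projectivization.mk ℂ (Z.α j) (Z.α_ne_zero j)) = logHeight (Z.rep j) / finrank ℚ K :=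
  habs_mk (K := K) (K.val : K →ₐ[ℚ] ℂ).toRingHom (Z.rep j) (Z.α_ne_zero j)

omit [NumberField K] in
/-- `j ↦ [α_j]` is injective (the representatives are pairwise non-proportional). [folklore] -/
theorem mk_α_injective :
    Function.Injective fun j => Projectivization.mk ℂ (Z.α j) (Z.α_ne_zero j) := by
  intro i j hij
  by_contra hne
  obtain ⟨a, ha⟩ := (Projectivization.mk_eq_mk_iff ℂ _ _ (Z.α_ne_zero i) (Z.α_ne_zero j)).mp hij
  exact Z.sep j i (Ne.symm hne) ⟨(a : ℂ), by rw [← ha]; rfl⟩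

variable [Normal ℚ K] [DecidableEq ι]

/-- **`conj [α_{i₀}] = {[α_j] : j ∈ orb i₀}`.** [cite: NguyenRoy2016, §4; Roy2013, §6] -/
theorem conj_algPt (i₀ : ι) :
    (algPt Z i₀).conj = (Z.orb i₀).image fun j => Projectivization.mk ℂ (Z.α j) (Z.α_ne_zero j) := by
  rw [(algPt Z i₀).conj_eq_image_aut (K := K) (Z.rep i₀) (Z.α_ne_zero i₀) rfl]
  ext q
  simp only [Finset.mem_image, Finset.mem_univ, true_and, ZeroConfigK.orb, Finset.mem_filter]
  constructor
  · rintro ⟨g, rfl⟩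
    refine ⟨Z.perm g i₀, ⟨g, rfl⟩, mk_congr _ _ ?_⟩
    exact (Z.img_eq g i₀).symm
  · rintro ⟨j, ⟨g, rfl⟩, rfl⟩
    exact ⟨g, mk_congr _ _ (Z.img_eq g i₀)⟩

/-- **`deg [α_{i₀}] = #orb i₀`.** [cite: NguyenRoy2016, §4] -/
theorem card_conj_algPt (i₀ : ι) : ((algPt Z i₀).conj).card = (Z.orb i₀).card := by
  rw [conj_algPt, Finset.card_image_of_injective _ (mk_α_injective Z)]

/-- **`ht [α_{i₀}] = ∑_{j ∈ orb i₀} h_K(rep j) / [K:ℚ]`** (the height of the component in the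
bookkeeping of seat B). [cite: NguyenRoy2016, §4 (`h(Z)`); Roy2013, §6] -/
theorem ht_algPt (i₀ : ι) :
    (algPt Z i₀).ht = (∑ j ∈ Z.orb i₀, logHeight (Z.rep j)) / finrank ℚ K := by
  have h1 : (algPt Z i₀).ht = ∑ q ∈ (algPt Z i₀).conj, habs q := by
    rw [Finset.sum_congr rfl fun q hq => (algPt Z i₀).habs_of_mem_conj hq, Finset.sum_const,
      (algPt Z i₀).card_conj, nsmul_eq_mul, AlgPt.ht]
  rw [h1, conj_algPt, Finset.sum_image fun i _ j _ h => mk_α_injective Z h, Finset.sum_div]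
  exact Finset.sum_congr rfl fun j _ => habs_mk_α Z j

end ZeroConfigBridge

end NguyenRoy

end Literature.NumberTheory.Transcendental

end
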